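import Mathlib
import HarnessLib
import Literature.Analysis.FunctionSpaces.FlatTorus
import Literature.Analysis.FluidPDE.StokesTorus

/-!
# The crossed-shear root of Euler + drift + Kolmogorov force on `T³` — definitions

Objects of the refutation witness for the Liouville cruxes `RootsPlanar` (stmt-AnomalousDissipation-28522,
route `SteadyCoherentFraction`) and `TameEulerClimatesPlanar` (stmt-27427, route `CoherentFraction`) of the
cell decomp-ad (census KILL E31, STATUS 2026-08-30T23:16:46Z, crit-certified on paper; independently lens-4 g22,
kernel spec `CrossedShearRoots.lean` a0e7b9766f80b4f9). On `T³ = (ℝ/ℤ)³` with the route's force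
`f_K = sin(4πx₁) e₀` the field `u = v + m`,
`v(x) = ( cos(4πx₁)/ρ(x₂) , (cos(4πx₀) + c_K)ρ(x₂) - c_K , 0 )`, `m = c_K e₁`, `ρ(t) = 1 + ½cos(2πt)`,
`c_K = -1/(4π)`, with pressure `p(x) = sin(4πx₀) sin(4πx₁)`, is a smooth divergence-free classical steady root of
Euler + drift: `(v·∇)v + Dv·m + ∇p = f_K`, `∫v = 0`; it is NOT planar (its `x₁`-independent component `v₁`
depends on both horizontal variables). Coordinate functions are written through the fundamental-domain
representative `repr` (`Literature/Analysis/FunctionSpaces/TorusCoordinateFunctions`). Proofs: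
`…RootsPlanarWitnessField`, `…WitnessRoot`, `…WitnessDefect`, `…RootsPlanarRefutation`.
-/

noncomputable section

-- `Summit.<Summit>.<Problem>` is the tree's mandated summit-side namespace (CONVENTIONS §2); for this
-- single-conjunct summit the two segments coincide, so the duplicate is deliberate.
set_option linter.dupNamespace false

namespace Summit.AnomalousDissipation.AnomalousDissipation.Theorems.CrossedShearRoot

open Literature.Analysis.FunctionSpaces Literature.Analysis.FunctionSpaces.Torus

/-- `c4 t = cos(4πt)`. [folklore] -/
def c4 (t : ℝ) : ℝ := Real.cos (4 * Real.pi * t)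

/-- `s4 t = sin(4πt)`. [folklore] -/
def s4 (t : ℝ) : ℝ := Real.sin (4 * Real.pi * t)

/-- `s2 t = sin(2πt)`. [folklore] -/
def s2 (t : ℝ) : ℝ := Real.sin (2 * Real.pi * t)

/-- The vertical profile `ρ(t) = 1 + ½cos(2πt) > 0` (`= 1/r` of the census memo NONPLANAR-ROOT-FAMILY.md). [folklore] -/
def rho (t : ℝ) : ℝ := 1 + Real.cos (2 * Real.pi * t) / 2

/-- `ρ'(t) = -π sin(2πt)`. [folklore] -/
def drho (t : ℝ) : ℝ := -(Real.pi * Real.sin (2 * Real.pi * t))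

/-- The drift amplitude `c_K = -1/(4π)` (so that `4π c_K = -1`). [folklore] -/
def cK : ℝ := -(1 / (4 * Real.pi))

/-- First component of the fluctuation: `v₀(x) = cos(4πx₁)/ρ(x₂)`. [folklore] -/
def V0 (x : UnitAddTorus (Fin 3)) : ℝ := c4 (repr x 1) / rho (repr x 2)

/-- Second component of the fluctuation: `v₁(x) = (cos(4πx₀) + c_K)ρ(x₂) - c_K` (zero mean since `∫ρ = 1`).
[folklore] -/
def V1 (x : UnitAddTorus (Fin 3)) : ℝ := (c4 (repr x 0) + cK) * rho (repr x 2) - cK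

/-- The crossed-shear fluctuation `v = (v₀, v₁, 0)`. [folklore] -/
def vfield (x : UnitAddTorus (Fin 3)) : EuclideanSpace ℝ (Fin 3) :=
  V0 x • EuclideanSpace.single (0 : Fin 3) (1 : ℝ) + V1 x • EuclideanSpace.single (1 : Fin 3) (1 : ℝ)

/-- The pressure `p(x) = sin(4πx₀) sin(4πx₁)`. [folklore] -/
def pres (x : UnitAddTorus (Fin 3)) : ℝ := s4 (repr x 0) * s4 (repr x 1)

/-- The drift (mean velocity) `m = c_K e₁`. [folklore] -/
def drift : EuclideanSpace ℝ (Fin 3) := EuclideanSpace.single (1 : Fin 3) cK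

/-- The route's Kolmogorov force `f_K = sin(4πx₁) e₀ = stokesMode (0,2,0) e₀ false`. [folklore] -/
def fK (x : UnitAddTorus (Fin 3)) : EuclideanSpace ℝ (Fin 3) :=
  Literature.Analysis.FluidPDE.Torus.stokesMode (![0, 2, 0] : Fin 3 → ℤ) (EuclideanSpace.single (0 : Fin 3) (1 : ℝ))
    false x

/-- Potential of `v₀` in `x₁`: `Φ₀ = sin(4πx₁)/(4π ρ(x₂))`, `∂₁Φ₀ = v₀`. [folklore] -/
def pot0 (x : UnitAddTorus (Fin 3)) : ℝ := s4 (repr x 1) / (4 * Real.pi) / rho (repr x 2)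

/-- First potential of `v₁`: `Φ₁ = sin(4πx₀)ρ(x₂)/(4π)`, `∂₀Φ₁ = cos(4πx₀)ρ(x₂)`. [folklore] -/
def pot1 (x : UnitAddTorus (Fin 3)) : ℝ := s4 (repr x 0) * rho (repr x 2) / (4 * Real.pi)

/-- Second potential of `v₁`: `Φ₂ = c_K sin(2πx₂)/(4π)`, `∂₂Φ₂ = c_K (ρ(x₂) - 1)`. [folklore] -/
def pot2 (x : UnitAddTorus (Fin 3)) : ℝ := cK * s2 (repr x 2) / (4 * Real.pi)

end Summit.AnomalousDissipation.AnomalousDissipation.Theorems.CrossedShearRoot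

end
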